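import Summits.AnomalousDissipation.AnomalousDissipation.Theorems.DegreeGateFrontHeadRungs
import Summits.AnomalousDissipation.AnomalousDissipation.Theses.DegreeGate
import HarnessLib

/-!
# DegreeGate — the finite-range walls in the mirror class (asides `LoudFiniteRangeTG`, `FiniteRangeWallsClearTG`, now theorems)

LANDABLE FORM (decomp-ad lens-5 g66; intended tree path
`Summits/AnomalousDissipation/AnomalousDissipation/Theorems/DegreeGateFiniteRangeWalls.lean`; a prover/census seat lands it
AFTER `Theorems/DegreeGateFrontHeadRungs.lean` (lens-5 g65), which it imports for the Fourier bookkeeping of `L²` classes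
(`fc`, `fc_eq_zero_of_axis`, `spectral_gap_bookkeeping`, `freqNormSq_fin3`); planners do not propose into Theorems/).
0 sorry; axioms ⊆ {propext, Classical.choice, Quot.sound}.

Route `route-AnomalousDissipation-DegreeGate` (sub-problem `AnomalousDissipation`, Taylor–Green force
`f_TG = (sin 2πx cos 2πy cos 2πz, −cos 2πx sin 2πy cos 2πz, 0)` = the tree constant `tgForce`, literally the lambda bound by
the route's items) keeps two FINITE-RANGE WALL statements of its earlier revisions as banked asides, both about the MIRROR
class `K` (a.e. `u(R_i x)_j = ∓ u(x)_j`, `R_i x = update x i (−x_i)`, sign `−` iff `j = i`; NO half-shift or quarter-turn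
symmetry, NO energy hypothesis) of steady weak solutions `u ∈ V` of NS_ν(f_TG) with the energy equation
`ν‖∇u‖² = (u, f_TG)`, on the viscosity range `1/100 ≤ ν ≤ 1/5`:

* `LoudFiniteRangeTG` (item stmt-AnomalousDissipation-27556): no such state has power `(u, f_TG)` exactly `1/200`;
* `FiniteRangeWallsClearTG` (item stmt-AnomalousDissipation-26255): no such state sits on the energy wall
  (`∫|u|² = 1` with `(u,f_TG) ≥ 1/200`) or on the power wall (`∫|u|² ≤ 1` with `(u,f_TG) = 1/200`).

This file proves both BY NAME (`loudFiniteRangeTG_holds`, `finiteRangeWallsClearTG_holds`) from three estimates valid for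
EVERY state of the class (no connectedness, no selection, no smallness):

* §1 `axis_or_two_le`: a lattice frequency either lies on a coordinate axis (this includes `k = 0`) or has `|k|² ≥ 2`;
  with «axis frequencies die by mirrors + incompressibility» (`fc_eq_zero_of_axis`) and `spectral_gap_bookkeeping` this is
  the POINCARÉ CONSTANT OF THE MIRROR CLASS, `8π² ∫|u|² ≤ ‖∇u‖²` (`mirror_poincare`);
* §2 `mirror_norm_bound`: with the energy equation, `16π²ν ‖u‖_{L²} ≤ 1`
  (`8π²ν‖u‖² ≤ ν‖∇u‖² = (u, f_TG) ≤ ‖f_TG‖ ‖u‖ = ‖u‖/2`), so `∫|u|² < 1` as soon as `16π²ν > 1`;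
* §3 `mirrorPowerFloor`: for `1/500 ≤ ν ≤ 2/5` every mirror-symmetric steady weak solution with the energy equation has
  `(u, f_TG) > 1/200` — the weak form tested with the force itself, `1/4 = 12π²ν(u,f_TG) − ∫(u·∇)f_TG·u` with
  `|∫(u·∇)f_TG·u| ≤ 2π∫|u|²` (`Theorems.DegreeGate.abs_inertialPairing_tgForce_le`, p824959), and §1 give
  `πν ≤ 48π³ν²(u,f_TG) + 8π²ν∫|u|² ≤ (48π³ν² + 1)(u,f_TG)`, incompatible with `(u,f_TG) ≤ 1/200` because
  `48π³ν² + 1 < 200πν` on that range (`loudFiniteRange_quad`);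
* §4 the two asides verbatim.

References: Temam 1979 Ch. II §1 (steady weak solutions, energy equation) [Temam1979]; FMRT 2001 Ch. II §§6–7 (Stokes
operator on the torus, Poincaré, the weak steady equation) [FMRTTurbulence2001]; Brachet et al., J. Fluid Mech. 130 (1983)
411–452, §2 (symmetries of the Taylor–Green vortex on Fourier modes) [doi:10.1017/s0022112083001159].
-/

noncomputable section

set_option linter.dupNamespace false
set_option linter.style.longLine false

open MeasureTheory Filter
open scoped InnerProductSpace
open Literature.Analysis Literature.Analysis.FunctionSpaces Literature.Analysis.FunctionSpaces.Torus
open Summit.AnomalousDissipation.AnomalousDissipation.Theorems.TaylorGreenLoudGalerkinStates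
open Summit.AnomalousDissipation.AnomalousDissipation.Theorems.TaylorGreenLoudGalerkinStates.Negative

namespace Summit.AnomalousDissipation.AnomalousDissipation.Theorems.DegreeGate

/-! ### §1 The Poincaré constant `8π²` of the mirror class -/

/-- On the lattice `ℤ³` a frequency either lies on a coordinate axis — all coordinates but one vanish, which includes
`k = 0` — or has `k₀² + k₁² + k₂² ≥ 2`. [folklore] -/
theorem axis_or_two_le (k : Fin 3 → ℤ) :
    (∃ i : Fin 3, ∀ l, l ≠ i → k l = 0) ∨ (2 : ℤ) ≤ k 0 ^ 2 + k 1 ^ 2 + k 2 ^ 2 := by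
  have hsq : ∀ z : ℤ, z ≠ 0 → 1 ≤ z ^ 2 := fun z hz => (one_le_sq_iff_one_le_abs z).2 (Int.one_le_abs hz)
  have h0 := sq_nonneg (k 0)
  have h1 := sq_nonneg (k 1)
  have h2 := sq_nonneg (k 2)
  by_cases hk0 : k 0 = 0
  · by_cases hk1 : k 1 = 0
    · exact Or.inl ⟨2, fun l hl => by fin_cases l <;> simp_all⟩
    · by_cases hk2 : k 2 = 0
      · exact Or.inl ⟨1, fun l hl => by fin_cases l <;> simp_all⟩
      · exact Or.inr (by linarith [hsq _ hk1, hsq _ hk2])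
  · by_cases hk1 : k 1 = 0
    · by_cases hk2 : k 2 = 0
      · exact Or.inl ⟨0, fun l hl => by fin_cases l <;> simp_all⟩
      · exact Or.inr (by linarith [hsq _ hk0, hsq _ hk2])
    · exact Or.inr (by linarith [hsq _ hk0, hsq _ hk1])

/-- **Poincaré `8π² ∫|u|² ≤ ‖∇u‖²` in the mirror class.** For `u ∈ V` whose `L²` class has the three coordinate mirrors
`u(R_i x)_j = ∓ u(x)_j` a.e., every frequency carrying energy has `|k|² ≥ 2`: the mean and the axis frequencies are
killed by mirrors + weak incompressibility (`fc_eq_zero_of_axis`); then `spectral_gap_bookkeeping`. [folklore] -/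
theorem mirror_poincare (u : ↥(energySpace (Fin 3)))
    (hV : (u : MeasureTheory.Lp (EuclideanSpace ℝ (Fin 3)) 2 (MeasureTheory.volume (α := UnitAddTorus (Fin 3)))) ∈ energySpaceV (Fin 3))
    (hM : ∀ i j : Fin 3, (fun x => ((u : MeasureTheory.Lp (EuclideanSpace ℝ (Fin 3)) 2 (MeasureTheory.volume (α := UnitAddTorus (Fin 3)))) : UnitAddTorus (Fin 3) → EuclideanSpace ℝ (Fin 3)) (Function.update x i (-x i)) j) =ᵐ[volume]
      (fun x => if j = i then -(((u : MeasureTheory.Lp (EuclideanSpace ℝ (Fin 3)) 2 (MeasureTheory.volume (α := UnitAddTorus (Fin 3)))) : UnitAddTorus (Fin 3) → EuclideanSpace ℝ (Fin 3)) x j) else ((u : MeasureTheory.Lp (EuclideanSpace ℝ (Fin 3)) 2 (MeasureTheory.volume (α := UnitAddTorus (Fin 3)))) : UnitAddTorus (Fin 3) → EuclideanSpace ℝ (Fin 3)) x j)) :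
    8 * Real.pi ^ 2 * (∫ x, ‖(u : MeasureTheory.Lp (EuclideanSpace ℝ (Fin 3)) 2 (MeasureTheory.volume (α := UnitAddTorus (Fin 3)))) x‖ ^ 2) ≤
      (eGradNormSq ((u : MeasureTheory.Lp (EuclideanSpace ℝ (Fin 3)) 2 (MeasureTheory.volume (α := UnitAddTorus (Fin 3)))) : UnitAddTorus (Fin 3) → EuclideanSpace ℝ (Fin 3))).toReal := by
  have hU : (u : MeasureTheory.Lp (EuclideanSpace ℝ (Fin 3)) 2 (MeasureTheory.volume (α := UnitAddTorus (Fin 3)))) ∈ energySpace (Fin 3) := u.2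
  have hfin : eGradNormSq ((u : MeasureTheory.Lp (EuclideanSpace ℝ (Fin 3)) 2 (MeasureTheory.volume (α := UnitAddTorus (Fin 3)))) : UnitAddTorus (Fin 3) → EuclideanSpace ℝ (Fin 3)) ≠ ⊤ :=
    (MemSobolev.eGradNormSq_lt_top hV.2).ne
  have hP := spectral_gap_bookkeeping (u : MeasureTheory.Lp (EuclideanSpace ℝ (Fin 3)) 2 (MeasureTheory.volume (α := UnitAddTorus (Fin 3)))) hfin (m := 2) (b := 0) (by norm_num) le_rfl ∅ fun k => by
    rcases axis_or_two_le k with ⟨i, hi⟩ | h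
    · exact Or.inl (fc_eq_zero_of_axis hU hM hi)
    · exact Or.inr (Or.inr (by rw [freqNormSq_fin3]; exact_mod_cast h))
  simp only [Finset.sum_empty, mul_zero, add_zero] at hP
  linarith

/-! ### §2 The energy ceiling of the mirror class -/

/-- **Energy ceiling in the mirror class.** If moreover `ν > 0` and the energy equation `ν‖∇u‖² = (u, f_TG)` holds, then
`16π²ν ‖u‖_{L²} ≤ 1`: indeed `8π²ν‖u‖² ≤ ν‖∇u‖² = (u, f_TG) ≤ ‖f_TG‖_{L²} ‖u‖ = ‖u‖/2`. [folklore] -/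
theorem mirror_norm_bound {ν : ℝ} (hν : 0 < ν) (u : ↥(energySpace (Fin 3)))
    (hV : (u : MeasureTheory.Lp (EuclideanSpace ℝ (Fin 3)) 2 (MeasureTheory.volume (α := UnitAddTorus (Fin 3)))) ∈ energySpaceV (Fin 3))
    (hEq : ν * (eGradNormSq ((u : MeasureTheory.Lp (EuclideanSpace ℝ (Fin 3)) 2 (MeasureTheory.volume (α := UnitAddTorus (Fin 3)))) : UnitAddTorus (Fin 3) → EuclideanSpace ℝ (Fin 3))).toReal =
      Literature.Analysis.FluidPDE.Torus.pairing (u : MeasureTheory.Lp (EuclideanSpace ℝ (Fin 3)) 2 (MeasureTheory.volume (α := UnitAddTorus (Fin 3)))) tgForce)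
    (hM : ∀ i j : Fin 3, (fun x => ((u : MeasureTheory.Lp (EuclideanSpace ℝ (Fin 3)) 2 (MeasureTheory.volume (α := UnitAddTorus (Fin 3)))) : UnitAddTorus (Fin 3) → EuclideanSpace ℝ (Fin 3)) (Function.update x i (-x i)) j) =ᵐ[volume]
      (fun x => if j = i then -(((u : MeasureTheory.Lp (EuclideanSpace ℝ (Fin 3)) 2 (MeasureTheory.volume (α := UnitAddTorus (Fin 3)))) : UnitAddTorus (Fin 3) → EuclideanSpace ℝ (Fin 3)) x j) else ((u : MeasureTheory.Lp (EuclideanSpace ℝ (Fin 3)) 2 (MeasureTheory.volume (α := UnitAddTorus (Fin 3)))) : UnitAddTorus (Fin 3) → EuclideanSpace ℝ (Fin 3)) x j)) :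
    16 * Real.pi ^ 2 * ν * ‖(u : MeasureTheory.Lp (EuclideanSpace ℝ (Fin 3)) 2 (MeasureTheory.volume (α := UnitAddTorus (Fin 3))))‖ ≤ 1 := by
  have hP := mirror_poincare u hV hM
  rw [Literature.Analysis.FluidPDE.Torus.integral_norm_sq_coe_eq] at hP
  -- (u, f_TG) ≤ ‖u‖ ‖f_TG‖ = ‖u‖ / 2
  have hD := (abs_le.1 (Literature.Analysis.FluidPDE.Torus.abs_pairing_coe_le (isSmooth_tgForce.memLp 2) u)).2
  rw [Literature.Analysis.FluidPDE.Torus.norm_toLp_eq_sqrt, integral_norm_sq_tgForce, Real.sqrt_inv,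
    show (4 : ℝ) = 2 ^ 2 by norm_num, Real.sqrt_sq (by norm_num : (0 : ℝ) ≤ 2), Submodule.coe_norm] at hD
  have hn0 : 0 ≤ ‖(u : MeasureTheory.Lp (EuclideanSpace ℝ (Fin 3)) 2 (MeasureTheory.volume (α := UnitAddTorus (Fin 3))))‖ := norm_nonneg _
  have hchain : 8 * Real.pi ^ 2 * ν * ‖(u : MeasureTheory.Lp (EuclideanSpace ℝ (Fin 3)) 2 (MeasureTheory.volume (α := UnitAddTorus (Fin 3))))‖ ^ 2 ≤ ‖(u : MeasureTheory.Lp (EuclideanSpace ℝ (Fin 3)) 2 (MeasureTheory.volume (α := UnitAddTorus (Fin 3))))‖ * 2⁻¹ := by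
    have := mul_le_mul_of_nonneg_left hP hν.le
    linarith [this, hEq, hD]
  rcases hn0.eq_or_lt with hz | hpos
  · rw [← hz, mul_zero]; exact zero_le_one
  · refine le_of_mul_le_mul_right ?_ hpos
    nlinarith [hchain]

/-! ### §3 The loud finite range of the mirror class -/

/-- Arithmetic of the loud finite range: `48π³ν² + 1 < 200πν` for `1/500 ≤ ν ≤ 2/5` (the roots of the quadratic are
`≈ 0.0016` and `≈ 0.42`). [folklore] -/
theorem loudFiniteRange_quad {ν : ℝ} (hν : (1/500 : ℝ) ≤ ν) (hν' : ν ≤ 2/5) :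
    48 * Real.pi ^ 3 * ν ^ 2 + 1 < 200 * Real.pi * ν := by
  have hπl := Real.pi_gt_d2
  have hπu := Real.pi_lt_d2
  have hπ0 : 0 < Real.pi := Real.pi_pos
  have hπ3 : Real.pi ^ 3 < 31.26 := by
    have h : Real.pi ^ 3 < 3.15 ^ 3 := by gcongr
    linarith [show (3.15 : ℝ) ^ 3 < 31.26 by norm_num]
  have hπ3l : 30.95 < Real.pi ^ 3 := by
    have h : (3.14 : ℝ) ^ 3 < Real.pi ^ 3 := by gcongr
    linarith [show (30.95 : ℝ) < 3.14 ^ 3 by norm_num]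
  -- ν² ≤ (1/500 + 2/5) ν − (1/500)(2/5) on the range
  have hsq : ν ^ 2 ≤ (201/500) * ν - 1/1250 := by nlinarith [mul_nonneg (sub_nonneg.2 hν) (sub_nonneg.2 hν')]
  have h48 : 48 * Real.pi ^ 3 * ν ^ 2 ≤ 48 * Real.pi ^ 3 * ((201/500) * ν - 1/1250) :=
    mul_le_mul_of_nonneg_left hsq (by positivity)
  nlinarith [h48, mul_le_mul_of_nonneg_right hπ3.le (sub_nonneg.2 hν), mul_le_mul_of_nonneg_right hπl.le (sub_nonneg.2 hν)]

/-- **The loud finite range of the mirror class (minimal hypotheses).** For `1/500 ≤ ν ≤ 2/5`, every steady weak solution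
`u ∈ V` of NS_ν(f_TG) with the energy equation `ν‖∇u‖² = (u, f_TG)` whose class has the three coordinate mirrors has
`(u, f_TG) > 1/200` (twice the route's loudness `ε₀ = 1/200`... as a strict floor at `ε₀`): the weak form tested with `f_TG`
gives `1/4 ≤ 12π²ν(u,f_TG) + 2π∫|u|²`, the mirror Poincaré constant gives `8π²ν∫|u|² ≤ (u,f_TG)`, hence
`πν ≤ (48π³ν² + 1)(u,f_TG)`, and `48π³ν² + 1 < 200πν`. No energy hypothesis: fat states are covered. [folklore] -/
theorem mirrorPowerFloor {ν : ℝ} (hν : (1/500 : ℝ) ≤ ν) (hν' : ν ≤ 2/5) (u : ↥(energySpace (Fin 3)))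
    (hV : (u : MeasureTheory.Lp (EuclideanSpace ℝ (Fin 3)) 2 (MeasureTheory.volume (α := UnitAddTorus (Fin 3)))) ∈ energySpaceV (Fin 3))
    (hsol : Literature.Analysis.FluidPDE.Torus.IsSteadyWeakSolution ν tgForce u)
    (hEq : ν * (eGradNormSq ((u : MeasureTheory.Lp (EuclideanSpace ℝ (Fin 3)) 2 (MeasureTheory.volume (α := UnitAddTorus (Fin 3)))) : UnitAddTorus (Fin 3) → EuclideanSpace ℝ (Fin 3))).toReal =
      Literature.Analysis.FluidPDE.Torus.pairing (u : MeasureTheory.Lp (EuclideanSpace ℝ (Fin 3)) 2 (MeasureTheory.volume (α := UnitAddTorus (Fin 3)))) tgForce)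
    (hM : ∀ i j : Fin 3, (fun x => ((u : MeasureTheory.Lp (EuclideanSpace ℝ (Fin 3)) 2 (MeasureTheory.volume (α := UnitAddTorus (Fin 3)))) : UnitAddTorus (Fin 3) → EuclideanSpace ℝ (Fin 3)) (Function.update x i (-x i)) j) =ᵐ[volume]
      (fun x => if j = i then -(((u : MeasureTheory.Lp (EuclideanSpace ℝ (Fin 3)) 2 (MeasureTheory.volume (α := UnitAddTorus (Fin 3)))) : UnitAddTorus (Fin 3) → EuclideanSpace ℝ (Fin 3)) x j) else ((u : MeasureTheory.Lp (EuclideanSpace ℝ (Fin 3)) 2 (MeasureTheory.volume (α := UnitAddTorus (Fin 3)))) : UnitAddTorus (Fin 3) → EuclideanSpace ℝ (Fin 3)) x j)) :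
    (1/200 : ℝ) < Literature.Analysis.FluidPDE.Torus.pairing (u : MeasureTheory.Lp (EuclideanSpace ℝ (Fin 3)) 2 (MeasureTheory.volume (α := UnitAddTorus (Fin 3)))) tgForce := by
  have hν0 : 0 < ν := lt_of_lt_of_le (by norm_num) hν
  have hπ0 : 0 < Real.pi := Real.pi_pos
  by_contra hle
  have hle' : Literature.Analysis.FluidPDE.Torus.pairing (u : MeasureTheory.Lp (EuclideanSpace ℝ (Fin 3)) 2 (MeasureTheory.volume (α := UnitAddTorus (Fin 3)))) tgForce ≤ 1/200 := not_lt.1 hle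
  have hE0 : 0 ≤ ∫ x, ‖(u : MeasureTheory.Lp (EuclideanSpace ℝ (Fin 3)) 2 (MeasureTheory.volume (α := UnitAddTorus (Fin 3)))) x‖ ^ 2 := integral_nonneg fun _ => by positivity
  -- the steady equation tested with the force itself: 1/4 ≤ 12π²ν(u,f) + 2π∫|u|²
  have h0 := hsol tgForce isSmooth_tgForce isDivFree_tgForce hasZeroMean_tgForce
  have hff : ∫ x, ⟪tgForce x, tgForce x⟫_ℝ = 4⁻¹ := by
    simp_rw [real_inner_self_eq_norm_sq]; exact integral_norm_sq_tgForce
  have hlap : ∫ x, ⟪((u : MeasureTheory.Lp (EuclideanSpace ℝ (Fin 3)) 2 (MeasureTheory.volume (α := UnitAddTorus (Fin 3)))) : UnitAddTorus (Fin 3) → EuclideanSpace ℝ (Fin 3)) x, Torus.laplacian tgForce x⟫_ℝ =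
      -(12 * Real.pi ^ 2) * Literature.Analysis.FluidPDE.Torus.pairing (u : MeasureTheory.Lp (EuclideanSpace ℝ (Fin 3)) 2 (MeasureTheory.volume (α := UnitAddTorus (Fin 3)))) tgForce := by
    simp_rw [Summit.AnomalousDissipation.AnomalousDissipation.Theorems.PumpedMirrorMirrorFloorTG.laplacian_tgForce_apply,
      real_inner_smul_right]
    rw [integral_const_mul]
    rfl
  simp only [Literature.Analysis.FluidPDE.Torus.nsGeneratorPairing, hff, hlap] at h0
  have hI := abs_le.1 (abs_inertialPairing_tgForce_le (u : MeasureTheory.Lp (EuclideanSpace ℝ (Fin 3)) 2 (MeasureTheory.volume (α := UnitAddTorus (Fin 3)))))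
  have hIeq : Literature.Analysis.FluidPDE.Torus.inertialPairing (u : MeasureTheory.Lp (EuclideanSpace ℝ (Fin 3)) 2 (MeasureTheory.volume (α := UnitAddTorus (Fin 3)))) tgForce =
      -(4⁻¹) + 12 * (Real.pi ^ 2 * (ν * Literature.Analysis.FluidPDE.Torus.pairing (u : MeasureTheory.Lp (EuclideanSpace ℝ (Fin 3)) 2 (MeasureTheory.volume (α := UnitAddTorus (Fin 3)))) tgForce)) := by
    linear_combination h0
  have h1 : 1/4 ≤ 12 * Real.pi ^ 2 * ν * Literature.Analysis.FluidPDE.Torus.pairing (u : MeasureTheory.Lp (EuclideanSpace ℝ (Fin 3)) 2 (MeasureTheory.volume (α := UnitAddTorus (Fin 3)))) tgForce +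
      2 * Real.pi * ∫ x, ‖(u : MeasureTheory.Lp (EuclideanSpace ℝ (Fin 3)) 2 (MeasureTheory.volume (α := UnitAddTorus (Fin 3)))) x‖ ^ 2 := by
    linarith [hI.1, hIeq]
  -- the mirror Poincaré constant: 8π²ν ∫|u|² ≤ ν‖∇u‖² = (u, f_TG)
  have hPo : 8 * Real.pi ^ 2 * ν * (∫ x, ‖(u : MeasureTheory.Lp (EuclideanSpace ℝ (Fin 3)) 2 (MeasureTheory.volume (α := UnitAddTorus (Fin 3)))) x‖ ^ 2) ≤ Literature.Analysis.FluidPDE.Torus.pairing (u : MeasureTheory.Lp (EuclideanSpace ℝ (Fin 3)) 2 (MeasureTheory.volume (α := UnitAddTorus (Fin 3)))) tgForce := by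
    have := mul_le_mul_of_nonneg_left (mirror_poincare u hV hM) hν0.le
    linarith [this, hEq]
  -- multiply the tested equation by 4πν
  have hA : Real.pi * ν ≤ 48 * Real.pi ^ 3 * ν ^ 2 * Literature.Analysis.FluidPDE.Torus.pairing (u : MeasureTheory.Lp (EuclideanSpace ℝ (Fin 3)) 2 (MeasureTheory.volume (α := UnitAddTorus (Fin 3)))) tgForce +
      8 * Real.pi ^ 2 * ν * (∫ x, ‖(u : MeasureTheory.Lp (EuclideanSpace ℝ (Fin 3)) 2 (MeasureTheory.volume (α := UnitAddTorus (Fin 3)))) x‖ ^ 2) := by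
    have := mul_le_mul_of_nonneg_left h1 (by positivity : (0 : ℝ) ≤ 4 * Real.pi * ν)
    linarith [this]
  have hB : 48 * Real.pi ^ 3 * ν ^ 2 * Literature.Analysis.FluidPDE.Torus.pairing (u : MeasureTheory.Lp (EuclideanSpace ℝ (Fin 3)) 2 (MeasureTheory.volume (α := UnitAddTorus (Fin 3)))) tgForce ≤
      48 * Real.pi ^ 3 * ν ^ 2 * (1/200) := mul_le_mul_of_nonneg_left hle' (by positivity)
  have hq := loudFiniteRange_quad hν hν'
  linarith [hA, hB, hPo, hle', hq]

/-! ### §4 The two asides of `route-AnomalousDissipation-DegreeGate`, verbatim -/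

/-- **Aside `LoudFiniteRangeTG`** (item stmt-AnomalousDissipation-27556 of `route-AnomalousDissipation-DegreeGate`, «W^P_fin,
LOUD FINITE RANGE»): for every `ν ∈ [1/100, 1/5]`, no mirror-symmetric steady weak solution `u ∈ V` of NS_ν(f_TG) with the
energy equation — of any energy — has power `(u, f_TG)` exactly `1/200`. By `mirrorPowerFloor` the power is `> 1/200`.
[folklore] -/
theorem loudFiniteRangeTG_holds :
    Summit.AnomalousDissipation.AnomalousDissipation.Theses.DegreeGate.LoudFiniteRangeTG := by
  intro f hf
  subst hf
  intro ν hν hν' u hG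
  -- the floor is stated with the tree constant `tgForce`, definitionally the route's lambda
  have h := mirrorPowerFloor (by linarith : (1/500 : ℝ) ≤ ν) (by linarith : ν ≤ 2/5) u hG.1 hG.2.1 hG.2.2.1 hG.2.2.2
  exact h.ne'

/-- **Aside `FiniteRangeWallsClearTG`** (item stmt-AnomalousDissipation-26255 of `route-AnomalousDissipation-DegreeGate`,
«W_fin, FINITE-RANGE WALLS»): for every `ν ∈ [1/100, 1/5]`, no mirror-symmetric steady weak solution `u ∈ V` of NS_ν(f_TG)
with the energy equation lies on the energy wall (`∫|u|² = 1`, `(u,f_TG) ≥ 1/200`) or on the power wall (`∫|u|² ≤ 1`,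
`(u,f_TG) = 1/200`): `∫|u|² ≤ 1/(256π⁴ν²) < 1` by `mirror_norm_bound`, and `(u,f_TG) > 1/200` by `mirrorPowerFloor`.
[folklore] -/
theorem finiteRangeWallsClearTG_holds :
    Summit.AnomalousDissipation.AnomalousDissipation.Theses.DegreeGate.FiniteRangeWallsClearTG := by
  intro f hf
  subst hf
  intro ν hν hν' u hG
  have hν0 : 0 < ν := lt_of_lt_of_le (by norm_num) hν
  have hfloor := mirrorPowerFloor (by linarith : (1/500 : ℝ) ≤ ν) (by linarith : ν ≤ 2/5) u hG.1 hG.2.1 hG.2.2.1 hG.2.2.2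
  have hn := mirror_norm_bound hν0 u hG.1 hG.2.2.1 hG.2.2.2
  have hE : (∫ x, ‖(u : MeasureTheory.Lp (EuclideanSpace ℝ (Fin 3)) 2 (MeasureTheory.volume (α := UnitAddTorus (Fin 3)))) x‖ ^ 2) < 1 := by
    rw [Literature.Analysis.FluidPDE.Torus.integral_norm_sq_coe_eq]
    have hn0 : 0 ≤ ‖(u : MeasureTheory.Lp (EuclideanSpace ℝ (Fin 3)) 2 (MeasureTheory.volume (α := UnitAddTorus (Fin 3))))‖ := norm_nonneg _
    have hc : (36/25 : ℝ) ≤ 16 * Real.pi ^ 2 * ν := by nlinarith [Real.pi_gt_three, Real.pi_pos, hν]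
    have hn1 : ‖(u : MeasureTheory.Lp (EuclideanSpace ℝ (Fin 3)) 2 (MeasureTheory.volume (α := UnitAddTorus (Fin 3))))‖ < 1 := by nlinarith [hn, hc, hn0]
    nlinarith [hn1, hn0]
  rintro (⟨hE1, _⟩ | ⟨_, hP⟩)
  · exact absurd hE1 hE.ne
  · exact absurd hP hfloor.ne'

end Summit.AnomalousDissipation.AnomalousDissipation.Theorems.DegreeGate

end
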